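import Summits.BirchSwinnertonDyer.Rank1Residual.X1.MuLambda
import Summits.BirchSwinnertonDyer.Rank1Residual.X1.MuDepth
import HarnessLib

/-!
# Residual class X1 ∩ {r = 0}: the μ-PART of Mazur's main conjecture FOLLOWS from Greenberg Prop. 5.7
# and the (per-pair certified) analytic bound `μ_an ≤ m`; Greenberg's μ-conjecture becomes a theorem there

HONEST FRAMING (cell `b2b-bsdres`, run/shared/lean/b2b/bsd-rank1-residual/, verbatim): the goal of the
cell is to DELETE the COMBINATION-SHAPED residual classes of the BSD formula for ALL analytic-rank
`≤ 1` curves over `ℚ` from PUBLISHED theorems only, and to TYPE what is not published; this is not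
"finishing BSD". Sub-cell `b2b-bsdres-eisenstein-p1` (CLASS-OWNERS row "X1 (r=0)"), gen 4: research
route; NO CLAIM BEYOND STATED CLASSES; nothing here changes a label.

WHY THIS FILE. `X1/MuLambda.lean` (gen 1) split Mazur's main conjecture at an Eisenstein pair into a
μ-PART (`MuPartAt W p`: `μ_an ≤ μ_alg`) and a λ-PART; `X1/MuDepth.lean` (gen 3) proved `μ_alg ≥ m` and
`μ_an ≥ m` at a member carrying a ramified (odd) CYCLIC `Γ_ℚ`-stable subgroup of order `p^m`
(Greenberg LNM 1716 Prop. 5.7, general form, + Kato–Wuthrich). The cell's census (iw-2, IWASAWA-CENSUS.md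
part II §4/§8.1) CERTIFIES the complementary analytic inequality: `μ_an = m_lb` at 7533/7533 members of
the 3101 X1/X2 classes with `N < 2·10⁴`. This file draws the consequence IN THE KERNEL (no new named
fact):
* `AnalyticMuLE W p m` (TYPED, checkable per pair — iw-2's certificate): some coefficient of the
  Néron-normalised `ϖ·L_p(f,α)` has norm `> p^{-(m+1)}` ("`μ_an(E) ≤ m`").
* `muPartAt_of_analyticMuLE_of_le_mu` / `muPartAt_of_ramified_cyclic_of_analyticMuLE` /
  `muPartAt_of_analyticMuLE_zero`: **the μ-part of Mazur's main conjecture HOLDS** at every good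
  ordinary Eisenstein pair, `p ≠ 2`, whose curve carries a ramified odd cyclic subgroup of order `p^m`
  (`m = 0`: nothing) and satisfies `AnalyticMuLE W p m` — the sandwich `μ_an ≤ m ≤ μ_alg`. NO input
  from Greenberg's (open) μ-conjecture `μ_alg = m_E`: the algebraic LOWER bound (Prop. 5.7) and the
  analytic UPPER bound suffice.
* `mu_eq_of_ramified_cyclic_of_analyticMuLE`, `mu_eq_zero_of_analyticMuLE_zero`: conversely, there
  **Greenberg's μ-conjecture is a THEOREM**: `μ(X(E/ℚ_∞)) = m` (and `μ_an = m`), by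
  `m ≤ μ_alg ≤ μ_an ≤ m` (`mu_generator_eq_muInvariant`: `μ(X)` = `μ` of any generator of `char X`).
* On the leaf (X1 ∧ r = 0): `Leaf.bsdp_iff_lambdaPartAt_of_ramified_cyclic_of_analyticMuLE` and its
  `m = 0` form — granted the PUBLISHED facts of `X1/MuLambda.lean` and the certificate,
  **`BSD(E,p) ⟺ the λ-part alone**.
So the Greenberg–Vatsal-route residue of the class (X1R0-GAPMAP.md §5: "{μ_alg = μ_an} ∧ {λ_alg ≥
λ_an}") sharpens to {`AnalyticMuLE`: "the Eisenstein-congruence depth of `L_p(E,T)` is the ramified-odd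
cyclic depth" — certified on every census member, OPEN class-wide (Bellaïche–Pollack 2019 Thm. 1.2
proves the analogue `μ ≤ ord_p(a_p − 1)` at tame level 1 only)} ∧ {λ-part}. Nothing asserted; no
label change.

References: [GreenbergLNM1716] Prop. 5.7 (PDF p. 139), Conj. 1.11, p. 180; [GreenbergVatsal2000] (1)–(2),
p. 4, result B; [Wuthrich2014] Thm. 16; [BellaichePollack2019] Thm. 1.2; [Washington1997] §7.1, §13.2;
HOME/b2b-bsdres-eisenstein-p1/X1R0-GAPMAP.md §5, §9.6, §10.6, §11; HOME/b2b-bsdres-iw-2/IWASAWA-CENSUS.md.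
-/

noncomputable section

open scoped Classical MatrixGroups ModularForm
open CongruenceSubgroup WeierstrassCurve Literature.NumberTheory.EllipticCurves
  Literature.NumberTheory.EllipticCurves.ModularForms Literature.NumberTheory.EllipticCurves.Rank1Residual
  Literature.NumberTheory.EllipticCurves.Greenberg1999
  Summit.BirchSwinnertonDyer.BirchSwinnertonDyer.Theorems.Rank1ResidualX1Defs
  Summit.BirchSwinnertonDyer.BirchSwinnertonDyer.Theorems.Rank1ResidualX1Converse
  Summit.BirchSwinnertonDyer.Rank1Residual.X1.MuLambda
  Summit.BirchSwinnertonDyer.Rank1Residual.X1.MuStructure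

set_option autoImplicit false

namespace Summit.BirchSwinnertonDyer.Rank1Residual.X1.MuPart

/-! ## §1. `Λ`-algebra: a large coefficient bounds `μ` from above; `μ` of a generator of `char M` -/

section Algebra

variable {p : ℕ} [Fact p.Prime]

/-- **A coefficient of norm `> p^{-(m+1)}` bounds `μ`: `μ(g) ≤ m`** (then `p^{m+1} ∤ g` in `Λ`;
Greenberg–Vatsal (2): `p^{μ}` is the exact power of `p` dividing `g`). [cite: GreenbergVatsal2000, p. 2, (2)] -/
theorem mu_le_of_lt_norm_coeff {g : IwasawaAlgebra p} {m n : ℕ}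
    (h : (p : ℝ) ^ (-((m : ℤ) + 1)) < ‖PowerSeries.coeff n (iwasawaToPowerSeries p g)‖) :
    mu g ≤ m := by
  by_contra hlt
  push Not at hlt
  have hg : g ≠ 0 := by
    rintro rfl
    rw [map_zero, map_zero, norm_zero] at h
    exact not_le.mpr h (by positivity)
  have hdvd : PowerSeries.C (p : ℤ_[p]) ^ (m + 1) ∣ g := by
    have hmu : PowerSeries.C (p : ℤ_[p]) ^ mu g ∣ g := by rw [← C_pow_eq]; exact C_pow_mu_dvd hg
    exact (pow_dvd_pow _ (Nat.succ_le_of_lt hlt)).trans hmu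
  have hle := norm_coeff_map_le_of_C_pow_dvd hdvd n
  push_cast at hle
  exact not_lt.mpr hle h

/-- **`μ` of a generator of the characteristic ideal is the μ-invariant of the module**: for a
finitely generated torsion `Λ`-module `M` with `char_Λ M = (g)`, `g ≠ 0`: `μ(g) = μ(M)` (structure
theorem: `g ~ p^{Σμᵢ}·∏ fⱼ^{nⱼ}`, `fⱼ` distinguished, `p ∤ ∏ fⱼ^{nⱼ}`, `μ(M) = Σ μᵢ`; tree theorems
`exists_isPseudoIsomorphism_elementary_holds`, `charIdeal_eq_span_holds`, `muInvariant_eq_sum_holds`,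
`C_dvd_charElement_iff`). [cite: Washington1997, §13.2] [cite: GreenbergVatsal2000, p. 2, (1)–(2)] -/
theorem mu_generator_eq_muInvariant (M : Type*) [AddCommGroup M] [Module (IwasawaAlgebra p) M]
    [Module.Finite (IwasawaAlgebra p) M] (hM : Module.IsTorsion (IwasawaAlgebra p) M)
    {g : IwasawaAlgebra p} (hg0 : g ≠ 0)
    (hg : Literature.NumberTheory.EllipticCurves.Module.charIdeal (IwasawaAlgebra p) M =
      Ideal.span {g}) :
    mu g = muInvariant p M := by
  obtain ⟨μs, fs, -, hfs, hψ⟩ := exists_isPseudoIsomorphism_elementary_holds p M hM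
  have hfs' : ∀ f ∈ fs, f.1.IsDistinguishedAt (IsLocalRing.maximalIdeal ℤ_[p]) :=
    fun f hf ↦ (hfs f hf).1
  have hchar : Literature.NumberTheory.EllipticCurves.Module.charIdeal (IwasawaAlgebra p) M =
      Ideal.span {charElement p μs fs} := charIdeal_eq_span_holds p M hfs' hψ
  have hμ : muInvariant p M = μs.sum := muInvariant_eq_sum_holds p M hfs' hψ
  obtain ⟨u, hu⟩ := Ideal.span_singleton_eq_span_singleton.mp (hg.symm.trans hchar)
  have hP : red (charElement p [] fs) ≠ 0 := by  -- `p ∤ ∏ fⱼ^{nⱼ} = charElement p [] fs`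
    rw [Ne, red_eq_zero_iff, C_dvd_charElement_iff hfs']; simp
  have hfacC : charElement p μs fs =
      PowerSeries.C ((p : ℤ_[p]) ^ μs.sum) * charElement p [] fs := by simp [charElement]
  have hmuC : mu (charElement p μs fs) = μs.sum := (mu_eq_and_pfree_eq hP hfacC).1
  have hu0 : mu (↑u : IwasawaAlgebra p) = 0 :=
    ((isUnit_iff_mu_eq_zero_and_lam_eq_zero _).mp u.isUnit).2.1
  have := mu_mul hg0 u.ne_zero
  rw [hu, hmuC, hu0, add_zero] at this
  rw [hμ, this]

end Algebra

/-! ## §2. The analytic bound `μ_an ≤ m`, TYPED (checkable per pair; nothing asserted) -/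

/-- **"`μ_an(E,p) ≤ m`" (TYPED; nothing asserted).** For the newform `f` of `E` at level `N_E` and
every rational `ϖ` with `ϖ·Ω_E = Ω⁺_f` (the Néron normalisation of `X1/MuLambda.lean`), SOME coefficient
of the `p`-adic `L`-function `ϖ·L_p(f,α)` (`α` the unit root) has `p`-adic norm `> p^{-(m+1)}` —
equivalently `p^{m+1}` does not divide `ϖ·L_p(E,T)` coefficientwise, i.e. the analytic μ-invariant is
`≤ m` in Greenberg–Vatsal's notation (2). This is a FINITE check on a single coefficient; the cell's
census certifies it with `m = m_lb` (the exhibited ramified-odd cyclic depth) at 7533/7533 members of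
the X1/X2 classes with `N < 2·10⁴` (iw-2, IWASAWA-CENSUS.md part II). Class-wide it is the analytic
twin of Greenberg's μ-conjecture (OPEN; cf. Bellaïche–Pollack 2019 Thm. 1.2 at tame level 1).
[cite: GreenbergVatsal2000, p. 2, (2) (shape only; nothing asserted)] -/
def AnalyticMuLE (W : WeierstrassCurve ℚ) [W.IsElliptic] [W.IsGloballyMinimal] (p : ℕ) [Fact p.Prime]
    (m : ℕ) : Prop :=
  ∀ [NeZero (W.conductorNorm ℤ)] (f : CuspForm (Gamma0 (W.conductorNorm ℤ)) 2),
    IsNewformOf W f → ∀ (ϖ : ℚ), (ϖ : ℝ) * W.realPeriodRat = plusPeriod f →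
    ∃ n : ℕ, (p : ℝ) ^ (-((m : ℤ) + 1)) <
      ‖PowerSeries.coeff n (PowerSeries.C (ϖ : ℚ_[p]) * padicLFunction f (unitRoot W p : ℚ_[p]))‖

/-! ## §3. The μ-part of Mazur's main conjecture from `μ_an ≤ m ≤ μ_alg` -/

section MuPart

variable {W : WeierstrassCurve ℚ} [W.IsElliptic] [W.IsGloballyMinimal] {p : ℕ} [Fact p.Prime]

/-- **μ-part from the sandwich `μ_an ≤ m ≤ μ_alg`.** At a good ordinary pair `(E,p)`, `p ≠ 2`, `E[p]`
reducible, granted Wuthrich 2014 Thm. 16 (`hW16`, PUBLISHED: `X(E/ℚ_∞)` torsion, `ϖ·L_p = ι(g')`,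
`g' ∈ char X`): if `μ(X(E/ℚ_∞)) ≥ m` for every cyclotomic torsion dual datum (`hdepth`) and
`AnalyticMuLE W p m` (`han`), then `MuPartAt W p`: `μ(g·h) ≤ m` (a large coefficient) and
`m ≤ μ(X) ⇒ p^m ∣ g ⇒ m ≤ μ(g)`. [cite: GreenbergVatsal2000, p. 4] [cite: Wuthrich2014, Thm. 16 (p. 397)] -/
theorem muPartAt_of_analyticMuLE_of_le_mu (hW16 : Wuthrich2014.charIdeal_dvd_padicLFunction)
    (hp : p ≠ 2) (hgood : W.HasGoodReductionAtPrime p) (hord : ¬ (p : ℤ) ∣ W.frobeniusTrace p)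
    (hred : ¬ W.HasIrreducibleModPGaloisRep p) {m : ℕ} (han : AnalyticMuLE W p m)
    (hdepth : ∀ (κ : ZpExtension ℚ p) (γ : Field.absoluteGaloisGroup ℚ),
      κ.IsCyclotomic → κ.IsTopGenerator γ → ∀ (D : W.SelmerDualData κ γ), D.IsTorsion → m ≤ D.mu) :
    MuPartAt W p := by
  intro κ γ hκ hγ hγ' _ f hf ϖ hϖ D g h hchar hι
  haveI : Module.Finite (IwasawaAlgebra p) D.X := D.module_finite_holds hγ
  obtain ⟨hD, -⟩ := hW16 W p hp ⟨hgood, hord⟩ hred hκ hγ hγ' hf D ϖ hϖ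
  have hgh : g * h ≠ 0 := mul_ne_zero_of_iota_eq hgood hord hf hϖ D hι
  have hg : g ≠ 0 := fun h0 => hgh (by rw [h0, zero_mul])
  have hpg : PowerSeries.C (p : ℤ_[p]) ^ m ∣ g :=
    C_pow_dvd_of_le_muInvariant D.X hD hchar (hdepth κ γ hκ hγ D hD)
  have h1 : m ≤ mu g := le_mu_of_C_pow_dvd hg (by rwa [C_pow_eq])
  obtain ⟨n, hn⟩ := han f hf ϖ hϖ
  rw [← hι] at hn
  exact (mu_le_of_lt_norm_coeff hn).trans h1

/-- **μ-part at the `μ_an = 0` members (no depth hypothesis)**: good ordinary Eisenstein pair, `p ≠ 2`,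
Wuthrich Thm. 16, and some coefficient of `ϖ·L_p(f,α)` a `p`-adic unit (`AnalyticMuLE W p 0`) ⇒
`MuPartAt W p`. Every census class has such a member (iw-2: 3101/3101, the `m_lb = 0` end).
[cite: GreenbergVatsal2000, p. 4] [cite: Wuthrich2014, Thm. 16 (p. 397)] -/
theorem muPartAt_of_analyticMuLE_zero (hW16 : Wuthrich2014.charIdeal_dvd_padicLFunction)
    (hp : p ≠ 2) (hgood : W.HasGoodReductionAtPrime p) (hord : ¬ (p : ℤ) ∣ W.frobeniusTrace p)
    (hred : ¬ W.HasIrreducibleModPGaloisRep p) (han : AnalyticMuLE W p 0) : MuPartAt W p :=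
  muPartAt_of_analyticMuLE_of_le_mu hW16 hp hgood hord hred han fun _ _ _ _ _ _ => Nat.zero_le _

/-- **μ-part at a member of ramified-odd cyclic depth `m` with `μ_an ≤ m`.** At a good ordinary pair
`(E,p)`, `p ≠ 2`, `E[p]` reducible, whose curve carries a `Γ_ℚ`-stable CYCLIC subgroup `Φ ≤ E(ℚ̄)` of
order `p^m` (`m ≥ 1`) with `p`-torsion line `Φ₁ ⊆ Φ` RAMIFIED at `p` and ODD, granted Greenberg LNM 1716
Prop. 5.7 in general form (`h57m`) and Wuthrich Thm. 16 (`hW16`), both PUBLISHED: `AnalyticMuLE W p m`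
implies `MuPartAt W p`. Greenberg's μ-conjecture is NOT used (`11a1@5`: `m = 1`; `11a2@5`: `m = 2`;
`14a1@3`: `m = 1`). [cite: GreenbergLNM1716, Prop. 5.7 (PDF p. 139)] [cite: Wuthrich2014, Thm. 16 (p. 397)] -/
theorem muPartAt_of_ramified_cyclic_of_analyticMuLE
    (hW16 : Wuthrich2014.charIdeal_dvd_padicLFunction) (h57m : prop57_le_mu_of_ramified_odd_cyclic)
    (hp : p ≠ 2) (hgood : W.HasGoodReductionAtPrime p) (hord : ¬ (p : ℤ) ∣ W.frobeniusTrace p)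
    (hred : ¬ W.HasIrreducibleModPGaloisRep p) {m : ℕ} (hm : 1 ≤ m) {Φ : AddSubgroup W.geomPoints}
    (hcyc : IsAddCyclic Φ) (hcard : Nat.card Φ = p ^ m)
    (hstab : ∀ σ : Field.absoluteGaloisGroup ℚ, ∀ P ∈ Φ, σ • P ∈ Φ)
    {Φ₁ : AddSubgroup (geomTorsion W (p : ℤ))} (hΦ₁ : IsRationalLine W p Φ₁)
    (hsub : ∀ P ∈ Φ₁, (P : W.geomPoints) ∈ Φ) (hram : ¬ LineUnramifiedAt W p Φ₁)
    (hodd : LineOdd W p Φ₁) (han : AnalyticMuLE W p m) : MuPartAt W p :=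
  muPartAt_of_analyticMuLE_of_le_mu hW16 hp hgood hord hred han fun _ _ hκ hγ D hD =>
    h57m.of_goodOrd W p hp hgood hord hm hcyc hcard hstab hΦ₁ hsub hram hodd hκ hγ D hD

/-- **Type-A form** (the parity supplies the oddness: on a pair with `¬ GVPar W p` a ramified rational
line is odd, `lineOdd_of_not_gvPar_of_ramified`): at a good ordinary Eisenstein pair of GV type A,
`p ≠ 2`, with a ramified cyclic `Γ_ℚ`-stable subgroup of order `p^m` and `AnalyticMuLE W p m`, the
μ-part of Mazur's main conjecture holds. Serves X1 in BOTH ranks (the leaf below; x1a/x1b's type-A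
rank-one pairs). [cite: GreenbergLNM1716, Prop. 5.7 (PDF p. 139)] [cite: GreenbergVatsal2000, §2 p. 28] -/
theorem muPartAt_of_not_gvPar_of_ramified_cyclic_of_analyticMuLE
    (hW16 : Wuthrich2014.charIdeal_dvd_padicLFunction) (h57m : prop57_le_mu_of_ramified_odd_cyclic)
    (hp : p ≠ 2) (hgood : W.HasGoodReductionAtPrime p) (hord : ¬ (p : ℤ) ∣ W.frobeniusTrace p)
    (hred : ¬ W.HasIrreducibleModPGaloisRep p) (hA : ¬ GVPar W p) {m : ℕ} (hm : 1 ≤ m)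
    {Φ : AddSubgroup W.geomPoints} (hcyc : IsAddCyclic Φ) (hcard : Nat.card Φ = p ^ m)
    (hstab : ∀ σ : Field.absoluteGaloisGroup ℚ, ∀ P ∈ Φ, σ • P ∈ Φ)
    {Φ₁ : AddSubgroup (geomTorsion W (p : ℤ))} (hΦ₁ : IsRationalLine W p Φ₁)
    (hsub : ∀ P ∈ Φ₁, (P : W.geomPoints) ∈ Φ) (hram : ¬ LineUnramifiedAt W p Φ₁)
    (han : AnalyticMuLE W p m) : MuPartAt W p :=
  muPartAt_of_ramified_cyclic_of_analyticMuLE hW16 h57m hp hgood hord hred hm hcyc hcard hstab hΦ₁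
    hsub hram (lineOdd_of_not_gvPar_of_ramified hA hΦ₁ hram) han

end MuPart

/-! ## §4. There Greenberg's μ-conjecture is a theorem: `μ_alg = μ_an = m` -/

section MuEq

variable {W : WeierstrassCurve ℚ} [W.IsElliptic] [W.IsGloballyMinimal] {p : ℕ} [Fact p.Prime]

/-- **`μ_alg = μ_an = m` at a member of ramified-odd cyclic depth `m` with `μ_an ≤ m`** (for the
explicit factorisation): hypotheses as in `muPartAt_of_ramified_cyclic_of_analyticMuLE`; for every
cyclotomic datum, newform `f`, `ϖ`, dual datum `D` and `g, h ∈ Λ` with `char X = (g)`,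
`ι(g·h) = ϖ·L_p(f,α)`: `μ(g) = m` AND `μ(g·h) = m` — the chain `m ≤ μ(X) = μ(g) ≤ μ(g·h) ≤ m`
(Prop. 5.7; `mu_generator_eq_muInvariant`; Kato's direction is free; the certificate): at such a member
`μ_E` takes the value Greenberg's conjecture predicts (LNM 1716 Conj. 1.11, p. 180), as a THEOREM
modulo two PUBLISHED facts and a finite certificate. [cite: GreenbergLNM1716, Prop. 5.7 (PDF p. 139) and Conj. 1.11]
[cite: GreenbergVatsal2000, p. 2 (1)–(2), p. 18 (result B)] [cite: Wuthrich2014, Thm. 16 (p. 397)] -/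
theorem mu_eq_and_mu_mul_eq_of_ramified_cyclic_of_analyticMuLE
    (hW16 : Wuthrich2014.charIdeal_dvd_padicLFunction) (h57m : prop57_le_mu_of_ramified_odd_cyclic)
    (hp : p ≠ 2) (hgood : W.HasGoodReductionAtPrime p) (hord : ¬ (p : ℤ) ∣ W.frobeniusTrace p)
    (hred : ¬ W.HasIrreducibleModPGaloisRep p) {m : ℕ} (hm : 1 ≤ m) {Φ : AddSubgroup W.geomPoints}
    (hcyc : IsAddCyclic Φ) (hcard : Nat.card Φ = p ^ m)
    (hstab : ∀ σ : Field.absoluteGaloisGroup ℚ, ∀ P ∈ Φ, σ • P ∈ Φ)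
    {Φ₁ : AddSubgroup (geomTorsion W (p : ℤ))} (hΦ₁ : IsRationalLine W p Φ₁)
    (hsub : ∀ P ∈ Φ₁, (P : W.geomPoints) ∈ Φ) (hram : ¬ LineUnramifiedAt W p Φ₁)
    (hodd : LineOdd W p Φ₁) (han : AnalyticMuLE W p m)
    {κ : ZpExtension ℚ p} {γ : Field.absoluteGaloisGroup ℚ}
    (hκ : κ.IsCyclotomic) (hγ : κ.IsTopGenerator γ) (hγ' : IsCyclotomicVariable p γ)
    [NeZero (W.conductorNorm ℤ)] {f : CuspForm (Gamma0 (W.conductorNorm ℤ)) 2} (hf : IsNewformOf W f)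
    {ϖ : ℚ} (hϖ : (ϖ : ℝ) * W.realPeriodRat = plusPeriod f) (D : W.SelmerDualData κ γ)
    {g h : IwasawaAlgebra p} (hchar : D.charIdeal = Ideal.span {g})
    (hι : iwasawaToPowerSeries p (g * h) =
      PowerSeries.C (ϖ : ℚ_[p]) * padicLFunction f (unitRoot W p : ℚ_[p])) :
    mu g = m ∧ mu (g * h) = m := by
  haveI : Module.Finite (IwasawaAlgebra p) D.X := D.module_finite_holds hγ
  obtain ⟨hD, -⟩ := hW16 W p hp ⟨hgood, hord⟩ hred hκ hγ hγ' hf D ϖ hϖ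
  have hgh : g * h ≠ 0 := mul_ne_zero_of_iota_eq hgood hord hf hϖ D hι
  have hg : g ≠ 0 := fun h0 => hgh (by rw [h0, zero_mul])
  have hh : h ≠ 0 := fun h0 => hgh (by rw [h0, mul_zero])
  -- `m ≤ μ(X) = μ(g)`
  have h1 : m ≤ mu g := by
    rw [mu_generator_eq_muInvariant D.X hD hg hchar]
    exact h57m.of_goodOrd W p hp hgood hord hm hcyc hcard hstab hΦ₁ hsub hram hodd hκ hγ D hD
  -- `μ(g) ≤ μ(g·h) ≤ m`
  have h2 : mu g ≤ mu (g * h) := mu_le_mu_mul hg hh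
  obtain ⟨n, hn⟩ := han f hf ϖ hϖ
  rw [← hι] at hn
  have h3 : mu (g * h) ≤ m := mu_le_of_lt_norm_coeff hn
  exact ⟨le_antisymm (h2.trans h3) h1, le_antisymm h3 (h1.trans h2)⟩

/-- **Kato–Wuthrich factorisation through a generator** (bookkeeping): at a good ordinary Eisenstein
pair, `p ≠ 2`, modularity (`hmod`, BCDT + Edixhoven: the newform `f` and a rational `ϖ` with
`ϖ·Ω_E = Ω⁺_f`, `exists_rat_mul_realPeriodRat_eq_plusPeriod`) and Wuthrich Thm. 16 give, for every
dual datum `D`: `X` is torsion and `ι(g·h) = ϖ·L_p(f,α)` with `char X = (g)` (principal,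
`charIdeal_isPrincipal_holds`). [cite: Wuthrich2014, Thm. 16 (p. 397)] [cite: BCDTJAMS2001, Theorem A] -/
theorem isTorsion_and_exists_factorisation (hW16 : Wuthrich2014.charIdeal_dvd_padicLFunction)
    (hmod : nonempty_modularParametrizationData)
    (hp : p ≠ 2) (hgood : W.HasGoodReductionAtPrime p) (hord : ¬ (p : ℤ) ∣ W.frobeniusTrace p)
    (hred : ¬ W.HasIrreducibleModPGaloisRep p) {κ : ZpExtension ℚ p} {γ : Field.absoluteGaloisGroup ℚ}
    (hκ : κ.IsCyclotomic) (hγ : κ.IsTopGenerator γ) (hγ' : IsCyclotomicVariable p γ)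
    [NeZero (W.conductorNorm ℤ)] (D : W.SelmerDualData κ γ) :
    D.IsTorsion ∧ ∃ (f : CuspForm (Gamma0 (W.conductorNorm ℤ)) 2) (ϖ : ℚ) (g h : IwasawaAlgebra p),
      IsNewformOf W f ∧ (ϖ : ℝ) * W.realPeriodRat = plusPeriod f ∧ D.charIdeal = Ideal.span {g} ∧
      iwasawaToPowerSeries p (g * h) =
        PowerSeries.C (ϖ : ℚ_[p]) * padicLFunction f (unitRoot W p : ℚ_[p]) := by
  obtain ⟨Dm⟩ := hmod W
  obtain ⟨ϖ, -, hϖ, -⟩ := Dm.exists_rat_mul_realPeriodRat_eq_plusPeriod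
  obtain ⟨hD, g', hg'mem, hι'⟩ := hW16 W p hp ⟨hgood, hord⟩ hred hκ hγ hγ' Dm.isNewformOf D ϖ hϖ
  obtain ⟨g, hg⟩ := (charIdeal_isPrincipal_holds p D.X).principal
  have hchar : D.charIdeal = Ideal.span {g} := hg
  have hdvd : g ∣ g' := by
    rw [hchar] at hg'mem
    exact Ideal.mem_span_singleton.mp hg'mem
  obtain ⟨h, hfac⟩ := hdvd
  exact ⟨hD, Dm.f, ϖ, g, h, Dm.isNewformOf, hϖ, hchar, hfac ▸ hι'⟩

/-- **Greenberg's μ-conjecture at such a member, as the value of the intrinsic invariant: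
`μ(X(E/ℚ_∞)) = m`.** Same hypotheses, plus modularity (`hmod`) so that the certificate `AnalyticMuLE`
can be read: for the cyclotomic data and EVERY dual datum `D`, `D.mu = m` (`11a1@5 ↦ 1`, `11a2@5 ↦ 2`).
[cite: GreenbergLNM1716, Conj. 1.11 and Prop. 5.7 (PDF p. 139)] [cite: Wuthrich2014, Thm. 16 (p. 397)]
[cite: BCDTJAMS2001, Theorem A] -/
theorem mu_eq_of_ramified_cyclic_of_analyticMuLE
    (hW16 : Wuthrich2014.charIdeal_dvd_padicLFunction) (h57m : prop57_le_mu_of_ramified_odd_cyclic)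
    (hmod : nonempty_modularParametrizationData)
    (hp : p ≠ 2) (hgood : W.HasGoodReductionAtPrime p) (hord : ¬ (p : ℤ) ∣ W.frobeniusTrace p)
    (hred : ¬ W.HasIrreducibleModPGaloisRep p) {m : ℕ} (hm : 1 ≤ m) {Φ : AddSubgroup W.geomPoints}
    (hcyc : IsAddCyclic Φ) (hcard : Nat.card Φ = p ^ m)
    (hstab : ∀ σ : Field.absoluteGaloisGroup ℚ, ∀ P ∈ Φ, σ • P ∈ Φ)
    {Φ₁ : AddSubgroup (geomTorsion W (p : ℤ))} (hΦ₁ : IsRationalLine W p Φ₁)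
    (hsub : ∀ P ∈ Φ₁, (P : W.geomPoints) ∈ Φ) (hram : ¬ LineUnramifiedAt W p Φ₁)
    (hodd : LineOdd W p Φ₁) (han : AnalyticMuLE W p m)
    {κ : ZpExtension ℚ p} {γ : Field.absoluteGaloisGroup ℚ}
    (hκ : κ.IsCyclotomic) (hγ : κ.IsTopGenerator γ) (hγ' : IsCyclotomicVariable p γ)
    (D : W.SelmerDualData κ γ) : D.mu = m := by
  haveI : NeZero (W.conductorNorm ℤ) := ⟨(W.conductorNorm_pos_holds).ne'⟩
  haveI : Module.Finite (IwasawaAlgebra p) D.X := D.module_finite_holds hγ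
  obtain ⟨hD, f, ϖ, g, h, hf, hϖ, hchar, hι⟩ :=
    isTorsion_and_exists_factorisation hW16 hmod hp hgood hord hred hκ hγ hγ' D
  have hgh : g * h ≠ 0 := mul_ne_zero_of_iota_eq hgood hord hf hϖ D hι
  have hg0 : g ≠ 0 := fun h0 => hgh (by rw [h0, zero_mul])
  have key := (mu_eq_and_mu_mul_eq_of_ramified_cyclic_of_analyticMuLE hW16 h57m hp hgood hord hred hm
    hcyc hcard hstab hΦ₁ hsub hram hodd han hκ hγ hγ' hf hϖ D hchar hι).1
  rw [SelmerDualData.mu, ← mu_generator_eq_muInvariant D.X hD hg0 hchar, key]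

/-- **`μ(X(E/ℚ_∞)) = 0` at the `μ_an = 0` members** (good ordinary Eisenstein pair, `p ≠ 2`; Wuthrich
Thm. 16 + modularity + the certificate `AnalyticMuLE W p 0`): Kato's direction alone, `μ(X) = μ(g) ≤
μ(g·h) = 0`. E.g. `11a3@5`, `14a4@3` — the φ-end of each census class (iw-2: 3101/3101 classes have a
`μ_an = 0` member), where Greenberg conjectures `μ = 0`. [cite: GreenbergLNM1716, Conj. 1.11]
[cite: Wuthrich2014, Thm. 16 (p. 397)] [cite: BCDTJAMS2001, Theorem A] -/
theorem mu_eq_zero_of_analyticMuLE_zero (hW16 : Wuthrich2014.charIdeal_dvd_padicLFunction)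
    (hmod : nonempty_modularParametrizationData)
    (hp : p ≠ 2) (hgood : W.HasGoodReductionAtPrime p) (hord : ¬ (p : ℤ) ∣ W.frobeniusTrace p)
    (hred : ¬ W.HasIrreducibleModPGaloisRep p) (han : AnalyticMuLE W p 0)
    {κ : ZpExtension ℚ p} {γ : Field.absoluteGaloisGroup ℚ}
    (hκ : κ.IsCyclotomic) (hγ : κ.IsTopGenerator γ) (hγ' : IsCyclotomicVariable p γ)
    (D : W.SelmerDualData κ γ) : D.mu = 0 := by
  haveI : NeZero (W.conductorNorm ℤ) := ⟨(W.conductorNorm_pos_holds).ne'⟩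
  haveI : Module.Finite (IwasawaAlgebra p) D.X := D.module_finite_holds hγ
  obtain ⟨hD, f, ϖ, g, h, hf, hϖ, hchar, hι⟩ :=
    isTorsion_and_exists_factorisation hW16 hmod hp hgood hord hred hκ hγ hγ' D
  have hgh : g * h ≠ 0 := mul_ne_zero_of_iota_eq hgood hord hf hϖ D hι
  have hg0 : g ≠ 0 := fun h0 => hgh (by rw [h0, zero_mul])
  have hh : h ≠ 0 := fun h0 => hgh (by rw [h0, mul_zero])
  obtain ⟨n, hn⟩ := han f hf ϖ hϖ
  rw [← hι] at hn
  rw [SelmerDualData.mu, ← mu_generator_eq_muInvariant D.X hD hg0 hchar]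
  exact Nat.le_zero.mp ((mu_le_mu_mul hg0 hh).trans (mu_le_of_lt_norm_coeff hn))

end MuEq

/-! ## §5. On the leaf (X1 ∧ r = 0): `BSD(E,p) ⟺ λ-part`, granted the certificate -/

section Leaf

variable {W : WeierstrassCurve ℚ} [W.IsElliptic] [W.IsGloballyMinimal] {p : ℕ} [Fact p.Prime]

/-- **μ-part on the leaf** at a member of ramified cyclic depth `m ≥ 1` with `AnalyticMuLE W p m`
(oddness from type A). [cite: GreenbergLNM1716, Prop. 5.7 (PDF p. 139)] [cite: Wuthrich2014, Thm. 16] -/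
theorem Leaf.muPartAt_of_ramified_cyclic_of_analyticMuLE
    (hW16 : Wuthrich2014.charIdeal_dvd_padicLFunction) (h57m : prop57_le_mu_of_ramified_odd_cyclic)
    (hL : RankZero.Leaf W p) {m : ℕ} (hm : 1 ≤ m) {Φ : AddSubgroup W.geomPoints}
    (hcyc : IsAddCyclic Φ) (hcard : Nat.card Φ = p ^ m)
    (hstab : ∀ σ : Field.absoluteGaloisGroup ℚ, ∀ P ∈ Φ, σ • P ∈ Φ)
    {Φ₁ : AddSubgroup (geomTorsion W (p : ℤ))} (hΦ₁ : IsRationalLine W p Φ₁)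
    (hsub : ∀ P ∈ Φ₁, (P : W.geomPoints) ∈ Φ) (hram : ¬ LineUnramifiedAt W p Φ₁)
    (han : AnalyticMuLE W p m) : MuPartAt W p :=
  have hX := isClassX1_of_classX1 hL.classX1
  muPartAt_of_not_gvPar_of_ramified_cyclic_of_analyticMuLE hW16 h57m hX.two_ne
    hX.hasGoodReductionAtPrime hX.not_dvd_frobeniusTrace hX.not_hasIrreducibleModPGaloisRep
    hL.not_gvPar hm hcyc hcard hstab hΦ₁ hsub hram han

/-- **μ-part on the leaf at a `μ_an = 0` member.** [cite: Wuthrich2014, Thm. 16 (p. 397)] -/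
theorem Leaf.muPartAt_of_analyticMuLE_zero (hW16 : Wuthrich2014.charIdeal_dvd_padicLFunction)
    (hL : RankZero.Leaf W p) (han : AnalyticMuLE W p 0) : MuPartAt W p :=
  have hX := isClassX1_of_classX1 hL.classX1
  MuPart.muPartAt_of_analyticMuLE_zero hW16 hX.two_ne hX.hasGoodReductionAtPrime
    hX.not_dvd_frobeniusTrace hX.not_hasIrreducibleModPGaloisRep han

/-- **On the leaf, at a member of ramified cyclic depth `m` with the certificate `μ_an ≤ m`:
`BSD(E,p) ⟺ the λ-part of Mazur's main conjecture.** Granted Wuthrich Thm. 16, Greenberg Prop. 5.7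
(general form), Greenberg Thm. 4.1, modularity and GZK (PUBLISHED named facts, as in
`X1/MuLambda.lean`): `BSDp W p ↔ LambdaPartAt W p`. With iw-2's census certificate (`μ_an = m_lb`,
7533/7533) this says: at every census member of the leaf the λ-part is the WHOLE residue of the
Greenberg–Vatsal route — a kernel implication, not a reading. [cite: GreenbergVatsal2000, p. 4]
[cite: GreenbergLNM1716, Prop. 5.7 (PDF p. 139), Thm. 4.1] [cite: Wuthrich2014, Thm. 16 (p. 397)] -/
theorem Leaf.bsdp_iff_lambdaPartAt_of_ramified_cyclic_of_analyticMuLE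
    (hW16 : Wuthrich2014.charIdeal_dvd_padicLFunction) (h57m : prop57_le_mu_of_ramified_odd_cyclic)
    (hGr : greenberg_charValue_rankZero) (hmod : nonempty_modularParametrizationData)
    (hGZK : rank_eq_analyticRank_of_analyticRank_le_one)
    (hL : RankZero.Leaf W p) {m : ℕ} (hm : 1 ≤ m) {Φ : AddSubgroup W.geomPoints}
    (hcyc : IsAddCyclic Φ) (hcard : Nat.card Φ = p ^ m)
    (hstab : ∀ σ : Field.absoluteGaloisGroup ℚ, ∀ P ∈ Φ, σ • P ∈ Φ)
    {Φ₁ : AddSubgroup (geomTorsion W (p : ℤ))} (hΦ₁ : IsRationalLine W p Φ₁)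
    (hsub : ∀ P ∈ Φ₁, (P : W.geomPoints) ∈ Φ) (hram : ¬ LineUnramifiedAt W p Φ₁)
    (han : AnalyticMuLE W p m) : BSDp W p ↔ LambdaPartAt W p := by
  rw [Leaf.bsdp_iff_muPart_and_lambdaPart hW16 hGr hmod hGZK hL]
  exact ⟨fun h => h.2, fun h => ⟨Leaf.muPartAt_of_ramified_cyclic_of_analyticMuLE hW16 h57m hL hm
    hcyc hcard hstab hΦ₁ hsub hram han, h⟩⟩

/-- **On the leaf, at a `μ_an = 0` member: `BSD(E,p) ⟺ the λ-part.** [cite: GreenbergVatsal2000, p. 4]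
[cite: Wuthrich2014, Thm. 16 (p. 397)] [cite: GreenbergLNM1716, Thm. 4.1] -/
theorem Leaf.bsdp_iff_lambdaPartAt_of_analyticMuLE_zero
    (hW16 : Wuthrich2014.charIdeal_dvd_padicLFunction) (hGr : greenberg_charValue_rankZero)
    (hmod : nonempty_modularParametrizationData) (hGZK : rank_eq_analyticRank_of_analyticRank_le_one)
    (hL : RankZero.Leaf W p) (han : AnalyticMuLE W p 0) : BSDp W p ↔ LambdaPartAt W p := by
  rw [Leaf.bsdp_iff_muPart_and_lambdaPart hW16 hGr hmod hGZK hL]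
  exact ⟨fun h => h.2, fun h => ⟨Leaf.muPartAt_of_analyticMuLE_zero hW16 hL han, h⟩⟩

end Leaf

end Summit.BirchSwinnertonDyer.Rank1Residual.X1.MuPart

end
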